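import Summits.CriticalPhenomena.PercolationContinuityZ3.Theorems.Transplant.ReflexSlabArms
import HarnessLib

/-!
# REFLEX sector-slabs `ℝ𝔽_c = {x ∈ S_k | x₂ ≥ 0 ∨ c·x₂ ≤ x₁}` (`c ≥ 0`; apertures `[270°, 360°)`): the station design, I — station and faces

builds on p205010 (kernel theorem, internal audit signed; external expert review pending) — NOT used in this file.
Lane `prim-bschramm`, seat `prim-bschramm-p2` (gen 23; class C1b, METHOD = input substitution; memo `HOME/bschramm/P2-LATTICES.md` §80);
helper file (`--supports stmt-CriticalPhenomena-4575 --as helper`).  `ℝ𝔽_c` is the slab cut by the planar REFLEX sector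
`{x₂ ≥ 0} ∪ {c·x₂ ≤ x₁}` = three-quarter plane `{x₁ ≥ 0 ∨ x₂ ≥ 0}` plus the pocket `{x₁, x₂ < 0, |x₁| ≤ c|x₂|}` of aperture `arctan c`
(`c = 0`: the three-quarter slab; every real `c ≥ 0`).  ACCFR design (coordinates `x₁` vertical, `x₂` horizontal): station `Ω = (0, N+1, −(4N+6))`
sweeping right to `Z = 3N+5` below height `T = 5N+7`; thin (`1/4`) steep arms from the top / right / left faces (the left face now reaches down to
`u₁ ≥ −c(N+1)`: its arm leans `−e₂`, and `c·x₂ ≤ c·b₂ ≤ b₁ ≤ x₁` keeps it in the pocket); window `M = k + 5N + 7`.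
* §1 membership helpers (`mem_rflx_of_nonneg`, `mem_rflx_of_arm`), `rflx_cyl`, `rflx_station_props`;
* §2 **`rflx_design_faces`**: the design at a top / right / left-face vertex (`P ≥ α₄·α·αₛ`, `≤ 2k+2` edges).
The bottom face (rightward chain for `u₂ ≥ 0`, LEFTWARD pocket chain for `u₂ < 0`) is in `ReflexSlabChains` (independent of this file); the assembled
`rflx_vertex_design` and the row are in `ReflexSlabRow`.
[cite: AizenmanChayesChayesFrohlichRusso1983, §4 Thm 4.4, Lemma 4.2 (a), Lemma 4.3, (4.26)] [cite: GrimmettPercolation1999, §7.2 p. 148] -/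

noncomputable section

namespace Summit.CriticalPhenomena.PercolationContinuityZ3.Theorems.Transplant

namespace ReflexSlab

open MeasureTheory Literature.Probability.Percolation Literature.Probability.LatticeModels SimpleGraph HSU OrthantUniq HalfSlabUniq
  ConeSlabUniq ThinConeSlab RationalHalfSlab ThreeQuarterSlab Filter
open scoped Classical Topology

variable {k : ℕ} {N : ℕ} {c : ℝ}

/-! ## §1 The reflex sector-slab: membership helpers, cylindricity, the station -/

/-- Membership in `ℝ𝔽_c`. [folklore] -/
theorem mem_rflx_iff {x : Site 3} :
    x ∈ {x : Site 3 | x ∈ slab 3 k ∧ (0 ≤ x 2 ∨ c * (x 2 : ℝ) ≤ (x 1 : ℝ))} ↔ (0 ≤ x 0 ∧ x 0 ≤ (k : ℤ)) ∧ (0 ≤ x 2 ∨ c * (x 2 : ℝ) ≤ (x 1 : ℝ)) :=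
  Iff.rfl

/-- `ℝ𝔽_c` lies in the slab. [folklore] -/
theorem rflx_subset_slab : {x : Site 3 | x ∈ slab 3 k ∧ (0 ≤ x 2 ∨ c * (x 2 : ℝ) ≤ (x 1 : ℝ))} ⊆ slab 3 k := fun _ hx => hx.1

/-- `ℝ𝔽_c` is cylindrical. [folklore] -/
theorem rflx_cyl : ∀ x ∈ {x : Site 3 | x ∈ slab 3 k ∧ (0 ≤ x 2 ∨ c * (x 2 : ℝ) ≤ (x 1 : ℝ))}, ∀ y ∈ slab 3 k, y 1 = x 1 → y 2 = x 2 →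
    y ∈ {x : Site 3 | x ∈ slab 3 k ∧ (0 ≤ x 2 ∨ c * (x 2 : ℝ) ≤ (x 1 : ℝ))} := by
  intro x hx y hy h1 h2
  exact ⟨hy, by rw [h1, h2]; exact hx.2⟩

/-- **The upper half `{x₁ ≥ 0}` of the slab lies in `ℝ𝔽_c`** (`c ≥ 0`). [folklore] -/
theorem mem_rflx_of_nonneg (hc : 0 ≤ c) {x : Site 3} (hx0 : x ∈ slab 3 k) (h1 : 0 ≤ x 1) :
    x ∈ {x : Site 3 | x ∈ slab 3 k ∧ (0 ≤ x 2 ∨ c * (x 2 : ℝ) ≤ (x 1 : ℝ))} := by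
  by_cases h2 : 0 ≤ x 2
  · exact ⟨hx0, Or.inl h2⟩
  · have h2r : (x 2 : ℝ) ≤ 0 := by exact_mod_cast (le_of_lt (not_le.1 h2))
    have h1r : (0 : ℝ) ≤ (x 1 : ℝ) := by exact_mod_cast h1
    exact ⟨hx0, Or.inr ((mul_nonpos_iff.2 (Or.inl ⟨hc, h2r⟩)).trans h1r)⟩

/-- **Arms leaning `−e₂` from an apex `b` with `c·b₂ ≤ b₁` stay in `ℝ𝔽_c`**: `x₂ ≤ b₂`, `b₁ ≤ x₁` (`c ≥ 0`). [folklore] -/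
theorem mem_rflx_of_arm (hc : 0 ≤ c) {b x : Site 3} (hb : c * (b 2 : ℝ) ≤ (b 1 : ℝ)) (hx0 : x ∈ slab 3 k) (h2 : x 2 ≤ b 2)
    (h1 : b 1 ≤ x 1) : x ∈ {x : Site 3 | x ∈ slab 3 k ∧ (0 ≤ x 2 ∨ c * (x 2 : ℝ) ≤ (x 1 : ℝ))} := by
  have h2r : (x 2 : ℝ) ≤ (b 2 : ℝ) := by exact_mod_cast h2
  have h1r : (b 1 : ℝ) ≤ (x 1 : ℝ) := by exact_mod_cast h1
  exact ⟨hx0, Or.inr (((mul_le_mul_of_nonneg_left h2r hc).trans hb).trans h1r)⟩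

/-- **The station's region**: `Ω = (0, N+1, −(4N+6))`, `Z = 3N+5`: inside `ℝ𝔽_c` (`x₁ ≥ N+1 ≥ 0`), off the box, below `T = 5N+7`. [folklore] -/
theorem rflx_station_props (hc : 0 ≤ c) {x : Site 3} (hx : x ∈ shallowReg k ![0, (N : ℤ) + 1, -(4 * (N : ℤ) + 6)] (3 * (N : ℤ) + 5)) :
    x ∈ {x : Site 3 | x ∈ slab 3 k ∧ (0 ≤ x 2 ∨ c * (x 2 : ℝ) ≤ (x 1 : ℝ))} ∧ x ∉ boxSet 3 N ∧ x 1 ≤ 5 * (N : ℤ) + 7 := by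
  obtain ⟨h0, h1, h2, h3, hZ⟩ := shallowReg_props hx
  simp only [Matrix.cons_val_one, Matrix.cons_val_zero, Matrix.cons_val] at h1 h2 h3
  exact ⟨mem_rflx_of_nonneg hc h0 (by omega), not_mem_boxSet_of_lt (j := 1) (by rw [abs_of_nonneg (by omega)]; omega), by omega⟩

/-! ## §2 The design at the top, right and left faces -/

/-- **The design at a top / right / left-face vertex of `ℝ𝔽_c`** (`c ≥ 0`, `N ≥ k+1`; `α₄` a thin-arm bound, `A` a slab arm kit at `p'`,
`αₛ ≤ 1` the swapped-arm bound carried for uniformity): an increasing event, measurable, determined by the edges of `[-M,M]³` (`M = k + 5N + 7`),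
of `P_{p'} ≥ α₄·α·αₛ`, on which `≤ 2k + 2` extra open edges join `u` to the station `Ω = (0, N+1, −(4N+6))` through open exterior steps of
`ℝ𝔽_c`: one thin arm (leaning `+e₂` from the top and right faces, `−e₂` from the left face — down to `u₁ ≥ −c(N+1)`) crossed by the sweep.
[cite: AizenmanChayesChayesFrohlichRusso1983, §4 Cor. to Lemma 4.3, Lemma 4.2 (a)] -/
theorem rflx_design_faces (hc : 0 ≤ c) (hN : k + 1 ≤ N) {p' : unitInterval} (A : SlabArmKit k p') {α₄ αₛ : ℝ} (hα₄ : 0 < α₄) (hαₛ1 : αₛ ≤ 1)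
    (harm₄ : ∀ σ : ℤ, (σ = 1 ∨ σ = -1) → ∀ b : Site 3, b ∈ slab 3 k →
      α₄ ≤ (bondPercolation (zdGraph 3) p').real (percolatesVia (withinGraph (zdGraph 3) (steepSet4 k σ b)) b))
    {u : Site 3} (hu : u ∈ boxSet 3 N) (huP : u ∈ {x : Site 3 | x ∈ slab 3 k ∧ (0 ≤ x 2 ∨ c * (x 2 : ℝ) ≤ (x 1 : ℝ))})
    (hface : u 1 = N ∨ u 2 = N ∨ (u 2 = -(N : ℤ) ∧ u - Pi.single 2 1 ∈ {x : Site 3 | x ∈ slab 3 k ∧ (0 ≤ x 2 ∨ c * (x 2 : ℝ) ≤ (x 1 : ℝ))})) :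
    ∃ E : Set (BondConfig (Site 3)), IsUpperSet E ∧ MeasurableSet E ∧ DeterminedBy E ↑(edgesIn (zdGraph 3) (box 3 (k + 5 * N + 7))) ∧
      α₄ * A.α * αₛ ≤ (bondPercolation (zdGraph 3) p').real E ∧
      ∀ ω ∈ E, ∃ F : Finset (Sym2 (Site 3)), F ⊆ edgesIn (zdGraph 3) (box 3 (k + 5 * N + 7)) ∧ F.card ≤ 2 * k + 2 ∧
        ω ∪ ↑F ∈ openConnVia (starGraph (withinGraph (zdGraph 3) {x : Site 3 | x ∈ slab 3 k ∧ (0 ≤ x 2 ∨ c * (x 2 : ℝ) ≤ (x 1 : ℝ))})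
          Set.univ (boxSet 3 N)) u ![0, (N : ℤ) + 1, -(4 * (N : ℤ) + 6)] := by
  obtain ⟨hu0, -⟩ := (mem_rflx_iff (k := k) (c := c)).1 huP
  have hub := mem_boxSet_iff.1 hu
  have hu1 := hub 1; have hu2 := hub 2
  set Ω : Site 3 := ![0, (N : ℤ) + 1, -(4 * (N : ℤ) + 6)] with hΩ_def
  have hΩ0 : Ω 0 = 0 := by simp [hΩ_def]
  have hΩ1 : Ω 1 = (N : ℤ) + 1 := by simp [hΩ_def]
  have hΩ2 : Ω 2 = -(4 * (N : ℤ) + 6) := by simp [hΩ_def]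
  have hΩslab : Ω ∈ slab 3 k := by show 0 ≤ Ω 0 ∧ Ω 0 ≤ (k : ℤ); rw [hΩ0]; exact ⟨le_rfl, by positivity⟩
  have hH : ∀ x ∈ shallowReg k Ω (3 * (N : ℤ) + 5), x ∈ {x : Site 3 | x ∈ slab 3 k ∧ (0 ≤ x 2 ∨ c * (x 2 : ℝ) ≤ (x 1 : ℝ))} ∧
      x ∉ boxSet 3 N ∧ x 1 ≤ 5 * (N : ℤ) + 7 := fun x hx => rflx_station_props hc hx
  have hwinH : ∀ x ∈ shallowReg k Ω (3 * (N : ℤ) + 5), ∀ j, |x j| ≤ (k + 5 * N + 7 : ℕ) := by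
    intro x hx j
    obtain ⟨h0, h1, h2, h3, hZ⟩ := shallowReg_props hx
    rw [hΩ1] at h1 h2; rw [hΩ2] at h2 h3
    fin_cases j <;> rw [abs_le] <;> push_cast <;> constructor <;> omega
  have hq0 : 0 ≤ α₄ * A.α := (mul_pos hα₄ A.α_pos).le
  have hprobH : A.α ≤ (bondPercolation (zdGraph 3) p').real
      (reachEvent (withinGraph (zdGraph 3) (shallowReg k Ω (3 * (N : ℤ) + 5))) Ω {x | x 2 = 3 * (N : ℤ) + 5}) :=
    le_real_of_subset (percolatesVia_subset_reachEvent_le (self_mem_shallowSet hΩslab) 2 (by rw [hΩ2]; omega)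
      (by simpa only [HalfSlabUniq.shallowReg] using shallowReg_finite (k := k) Ω (3 * (N : ℤ) + 5))) (A.shallow_arm Ω hΩslab)
  -- generic packaging: one thin arm from an apex `b`, crossed by the sweep
  have pack : ∀ {σ : ℤ} (_ : σ = 1 ∨ σ = -1) {b : Site 3} (_ : b ∈ slab 3 k) (_ : -(N : ℤ) ≤ b 1) (_ : b 1 ≤ (N : ℤ) + 1) (_ : |b 2| ≤ (N : ℤ) + 1)
      (_ : ∀ x ∈ steepSet4 k σ b ∩ {x | x 1 ≤ 5 * (N : ℤ) + 7},
        x ∈ {x : Site 3 | x ∈ slab 3 k ∧ (0 ≤ x 2 ∨ c * (x 2 : ℝ) ≤ (x 1 : ℝ))} ∧ x ∉ boxSet 3 N)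
      (Esc : Finset (Sym2 (Site 3))) (_ : Esc ⊆ edgesIn (zdGraph 3) (box 3 (k + 5 * N + 7))) (_ : Esc.card ≤ 2)
      (_ : ∀ (ω : BondConfig (Site 3)) (F : Finset (Sym2 (Site 3))), Esc ⊆ F →
        ω ∪ ↑F ∈ openConnVia (starGraph (withinGraph (zdGraph 3) {x : Site 3 | x ∈ slab 3 k ∧ (0 ≤ x 2 ∨ c * (x 2 : ℝ) ≤ (x 1 : ℝ))})
          Set.univ (boxSet 3 N)) b Ω →
        ω ∪ ↑F ∈ openConnVia (starGraph (withinGraph (zdGraph 3) {x : Site 3 | x ∈ slab 3 k ∧ (0 ≤ x 2 ∨ c * (x 2 : ℝ) ≤ (x 1 : ℝ))})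
          Set.univ (boxSet 3 N)) u Ω),
      ∃ E : Set (BondConfig (Site 3)), IsUpperSet E ∧ MeasurableSet E ∧ DeterminedBy E ↑(edgesIn (zdGraph 3) (box 3 (k + 5 * N + 7))) ∧
        α₄ * A.α * αₛ ≤ (bondPercolation (zdGraph 3) p').real E ∧
        ∀ ω ∈ E, ∃ F : Finset (Sym2 (Site 3)), F ⊆ edgesIn (zdGraph 3) (box 3 (k + 5 * N + 7)) ∧ F.card ≤ 2 * k + 2 ∧
          ω ∪ ↑F ∈ openConnVia (starGraph (withinGraph (zdGraph 3) {x : Site 3 | x ∈ slab 3 k ∧ (0 ≤ x 2 ∨ c * (x 2 : ℝ) ≤ (x 1 : ℝ))})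
            Set.univ (boxSet 3 N)) u Ω := by
    intro σ hσ b hb hb1lo hb1hi hb2 hSD Esc hEsc hEscc hEscMove
    have hb2' := abs_le.1 hb2
    set T : ℤ := 5 * (N : ℤ) + 7 with hT
    set S : Set (Site 3) := steepSet4 k σ b ∩ {x | x 1 ≤ T} with hS_def
    have hbS : b ∈ S := ⟨self_mem_steepSet4 hb, by show b 1 ≤ T; omega⟩
    have hSprops : ∀ x ∈ S, (0 ≤ x 0 ∧ x 0 ≤ (k : ℤ)) ∧ b 1 ≤ x 1 ∧ x 1 ≤ T ∧ 0 ≤ σ * (x 2 - b 2) ∧ σ * (x 2 - b 2) ≤ 2 * (N : ℤ) + 2 := by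
      rintro x ⟨⟨h0, h1, h2⟩, hxT⟩
      have hxT' : x 1 ≤ T := hxT
      exact ⟨h0, by omega, hxT', h1, by omega⟩
    have hSz : ∀ x ∈ S, Ω 2 ≤ x 2 ∧ x 2 ≤ 3 * (N : ℤ) + 5 := by
      intro x hx
      obtain ⟨-, -, -, h1, h2⟩ := hSprops x hx
      rw [hΩ2]
      rcases hσ with rfl | rfl
      · rw [one_mul] at h1 h2; constructor <;> omega
      · rw [neg_one_mul] at h1 h2; constructor <;> omega
    have hM : ∀ x ∈ S ∪ shallowReg k Ω (3 * (N : ℤ) + 5), ∀ j, |x j| ≤ (k + 5 * N + 7 : ℕ) := by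
      rintro x (hx | hx) j
      · obtain ⟨h0, h1, h2, -, -⟩ := hSprops x hx
        obtain ⟨h3, h4⟩ := hSz x hx
        rw [hΩ2] at h3
        fin_cases j <;> rw [abs_le] <;> push_cast <;> constructor <;> omega
      · exact hwinH x hx j
    set E : Set (BondConfig (Site 3)) := reachEvent (withinGraph (zdGraph 3) S) b {x | x 1 = T} ∩
      reachEvent (withinGraph (zdGraph 3) (shallowReg k Ω (3 * (N : ℤ) + 5))) Ω {x | x 2 = 3 * (N : ℤ) + 5} with hE
    have hSfin : S.Finite := (boxSet_finite _).subset (subset_boxSet_of_abs_le fun x hx => hM x (Or.inl hx))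
    have hprobS : α₄ ≤ (bondPercolation (zdGraph 3) p').real (reachEvent (withinGraph (zdGraph 3) S) b {x | x 1 = T}) :=
      le_real_of_subset (percolatesVia_subset_reachEvent_le (self_mem_steepSet4 hb) 1 (by omega)
        (by simpa [hS_def] using hSfin)) (harm₄ σ hσ b hb)
    refine ⟨E, (isUpperSet_reachEvent _ _ _).inter (isUpperSet_reachEvent _ _ _),
      (measurableSet_reachEvent _ _ _).inter (measurableSet_reachEvent _ _ _), ?_, ?_, fun ω hω => ?_⟩
    · exact ((determinedBy_reachEvent _ _ _).mono (edgeSet_withinGraph_subset_edgesIn (subset_boxSet_of_abs_le fun x hx =>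
        hM x (Or.inl hx)))).inter ((determinedBy_reachEvent _ _ _).mono (edgeSet_withinGraph_subset_edgesIn
          (subset_boxSet_of_abs_le fun x hx => hM x (Or.inr hx))))
    · exact (mul_le_of_le_one_right hq0 hαₛ1).trans (harris2_of_le p' (isUpperSet_reachEvent _ _ _) (isUpperSet_reachEvent _ _ _)
        (measurableSet_reachEvent _ _ _) (measurableSet_reachEvent _ _ _) hα₄.le hprobS hprobH)
    · obtain ⟨F, hFs, hFc, hFr⟩ := move_apex_cyl_region (D := {x : Site 3 | x ∈ slab 3 k ∧ (0 ≤ x 2 ∨ c * (x 2 : ℝ) ≤ (x 1 : ℝ))})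
        (by omega) rflx_cyl (S := S) (fun x hx => (hSprops x hx).1) hbS hΩslab (by rw [hΩ2]; omega) (by rw [hΩ1]; omega)
        (fun x hx => ⟨(hSD x hx).1, (hSD x hx).2, ⟨(hSprops x hx).2.1, (hSprops x hx).2.2.1⟩, hSz x hx⟩) hH hM hω
      refine ⟨Esc ∪ F, Finset.union_subset hEsc hFs, (Finset.card_union_le _ _).trans (by omega), ?_⟩
      exact hEscMove ω (Esc ∪ F) Finset.subset_union_left (openConnVia_mono_finset Finset.subset_union_right hFr)
  have hwu : ∀ j, |u j| ≤ (k + 5 * N + 7 : ℕ) := abs_le_of_mem_boxSet hu (by omega)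
  rcases hface with htop | hright | ⟨hleft, hbD⟩
  · -- TOP face: escape `u → u + e₁ → u + e₁ + e₂`, thin arm leaning `+e₂` (stays in `{x₁ ≥ N+1}`)
    set m : Site 3 := u + Pi.single 1 1 with hm_def
    set b : Site 3 := m + Pi.single 2 1 with hb_def
    have hm0 : m 0 = u 0 := by simp [hm_def]
    have hm1 : m 1 = u 1 + 1 := by simp [hm_def]
    have hm2 : m 2 = u 2 := by simp [hm_def]
    have hb0 : b 0 = u 0 := by simp [hb_def, hm0]
    have hb1 : b 1 = u 1 + 1 := by simp [hb_def, hm1]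
    have hb2 : b 2 = u 2 + 1 := by simp [hb_def, hm2]
    have hmslab : m ∈ slab 3 k := by show 0 ≤ m 0 ∧ m 0 ≤ (k : ℤ); rw [hm0]; exact hu0
    have hbslab : b ∈ slab 3 k := by show 0 ≤ b 0 ∧ b 0 ≤ (k : ℤ); rw [hb0]; exact hu0
    have hmP := mem_rflx_of_nonneg hc hmslab (by rw [hm1, htop]; positivity)
    have hbP := mem_rflx_of_nonneg hc hbslab (by rw [hb1, htop]; positivity)
    have hmbox : m ∉ boxSet 3 N := not_mem_boxSet_of_lt (j := 1) (by rw [hm1, abs_of_nonneg (by omega)]; omega)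
    have hadj1 : (zdGraph 3).Adj u m := (zdGraph_adj_iff _ _).2 ⟨1, Or.inl rfl⟩
    have hadj2 : (zdGraph 3).Adj m b := (zdGraph_adj_iff _ _).2 ⟨2, Or.inl rfl⟩
    have hwm : ∀ j, |m j| ≤ (k + 5 * N + 7 : ℕ) := abs_le_of_mem_boxSet (add_single_mem_boxSet hu 1) (by omega)
    have hwb : ∀ j, |b j| ≤ (k + 5 * N + 7 : ℕ) := abs_le_of_mem_boxSet (add_single_mem_boxSet (add_single_mem_boxSet hu 1) 2) (by omega)
    refine pack (Or.inl rfl) hbslab (by rw [hb1, htop]; omega) (by rw [hb1, htop]) (by rw [hb2, abs_le]; constructor <;> omega)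
      (fun x hx => ?_) {s(u, m), s(m, b)} ?_ (Finset.card_insert_le _ _ |>.trans (by simp)) (fun ω F hEF h => ?_)
    · obtain ⟨⟨h0, h1, h2⟩, -⟩ := hx
      rw [hb2, one_mul] at h1 h2; rw [hb1, htop] at h2
      exact ⟨mem_rflx_of_nonneg hc h0 (by omega), not_mem_boxSet_of_lt (j := 1) (by rw [abs_of_nonneg (by omega)]; omega)⟩
    · intro e he
      rcases Finset.mem_insert.1 he with rfl | he
      · exact mem_edgesIn_of_adj hadj1 hwu hwm
      · rw [Finset.mem_singleton] at he; rw [he]; exact mem_edgesIn_of_adj hadj2 hwm hwb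
    · refine openConnVia_step (dext_adj_of hadj1 huP hmP fun h' => hmbox h'.2) (hEF (Finset.mem_insert_self _ _))
        (openConnVia_step (dext_adj_of hadj2 hmP hbP fun h' => hmbox h'.1) (hEF ?_) h)
      exact Finset.mem_insert_of_mem (Finset.mem_singleton_self _)
  · -- RIGHT face: escape `u → u + e₂`, thin arm leaning `+e₂` (stays in `{x₂ ≥ N+1}`)
    set b : Site 3 := u + Pi.single 2 1 with hb_def
    have hb0 : b 0 = u 0 := by simp [hb_def]
    have hb1 : b 1 = u 1 := by simp [hb_def]
    have hb2 : b 2 = u 2 + 1 := by simp [hb_def]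
    have hbslab : b ∈ slab 3 k := by show 0 ≤ b 0 ∧ b 0 ≤ (k : ℤ); rw [hb0]; exact hu0
    have hbP : b ∈ {x : Site 3 | x ∈ slab 3 k ∧ (0 ≤ x 2 ∨ c * (x 2 : ℝ) ≤ (x 1 : ℝ))} :=
      ⟨hbslab, Or.inl (by rw [hb2, hright]; positivity)⟩
    have hbbox : b ∉ boxSet 3 N := not_mem_boxSet_of_lt (j := 2) (by rw [hb2, hright, abs_of_nonneg (by omega)]; omega)
    have hadj : (zdGraph 3).Adj u b := (zdGraph_adj_iff _ _).2 ⟨2, Or.inl rfl⟩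
    have hwb : ∀ j, |b j| ≤ (k + 5 * N + 7 : ℕ) := abs_le_of_mem_boxSet (add_single_mem_boxSet hu 2) (by omega)
    refine pack (Or.inl rfl) hbslab (by rw [hb1]; omega) (by rw [hb1]; omega) (by rw [hb2, hright]; exact abs_le.2 ⟨by omega, by omega⟩)
      (fun x hx => ?_) {s(u, b)} ?_ (by simp) (fun ω F hEF h => ?_)
    · obtain ⟨⟨h0, h1, h2⟩, -⟩ := hx
      rw [hb2, hright, one_mul] at h1 h2
      exact ⟨⟨h0, Or.inl (by omega)⟩, not_mem_boxSet_of_lt (j := 2) (by rw [abs_of_nonneg (by omega)]; omega)⟩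
    · intro e he
      rw [Finset.mem_singleton] at he; rw [he]; exact mem_edgesIn_of_adj hadj hwu hwb
    · exact openConnVia_step (dext_adj_of hadj huP hbP fun h' => hbbox h'.2) (hEF (Finset.mem_singleton_self _)) h
  · -- LEFT face (`u₁ ≥ 0` or in the pocket `−c(N+1) ≤ u₁ < 0`): escape `u → u − e₂ =: b ∈ ℝ𝔽_c`, thin arm leaning `−e₂`
    set b : Site 3 := u - Pi.single 2 1 with hb_def
    have hb0 : b 0 = u 0 := by simp [hb_def]
    have hb1 : b 1 = u 1 := by simp [hb_def]
    have hb2 : b 2 = u 2 - 1 := by simp [hb_def]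
    have hbslab : b ∈ slab 3 k := by show 0 ≤ b 0 ∧ b 0 ≤ (k : ℤ); rw [hb0]; exact hu0
    have hbc : c * (b 2 : ℝ) ≤ (b 1 : ℝ) := by
      rcases hbD.2 with h | h
      · exfalso; rw [hb2, hleft] at h; omega
      · exact h
    have hbbox : b ∉ boxSet 3 N := not_mem_boxSet_of_lt (j := 2) (by rw [hb2, hleft, abs_of_nonpos (by omega)]; omega)
    have hadj : (zdGraph 3).Adj u b := (zdGraph_adj_iff _ _).2 ⟨2, Or.inr (by rw [hb_def, sub_add_cancel])⟩
    have hwb : ∀ j, |b j| ≤ (k + 5 * N + 7 : ℕ) := abs_le_of_mem_boxSet (sub_single_mem_boxSet hu 2) (by omega)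
    refine pack (Or.inr rfl) hbslab (by rw [hb1]; omega) (by rw [hb1]; omega) (by rw [hb2, hleft]; exact abs_le.2 ⟨by omega, by omega⟩)
      (fun x hx => ?_) {s(u, b)} ?_ (by simp) (fun ω F hEF h => ?_)
    · obtain ⟨⟨h0, h1, h2⟩, -⟩ := hx
      rw [neg_one_mul] at h1 h2
      refine ⟨mem_rflx_of_arm hc hbc h0 (by omega) (by omega), not_mem_boxSet_of_lt (j := 2) ?_⟩
      rw [hb2, hleft] at h1; rw [abs_of_nonpos (by omega)]; omega
    · intro e he
      rw [Finset.mem_singleton] at he; rw [he]; exact mem_edgesIn_of_adj hadj hwu hwb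
    · exact openConnVia_step (dext_adj_of hadj huP hbD fun h' => hbbox h'.2) (hEF (Finset.mem_singleton_self _)) h

end ReflexSlab

end Summit.CriticalPhenomena.PercolationContinuityZ3.Theorems.Transplant

end
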